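import Summits.Ventures.HodgeRepro.Tier4.Common.SL2ConeMeasure

/-!
# Tier4/Common/SL2BallFubini — the cone over the `ℓ¹` ball of `SL(2, ℝ)` has Lebesgue measure `≤ 16 R² (8 + 6 log (2R²))`

Blind re-derivation cell `pub-hodge-repro`, Tier 4 (README §9–§10), seat t4-typer-2 (gen 5).  Target tree path
`lean/Summits/Ventures/HodgeRepro/Tier4/Common/SL2BallFubini.lean`; imports Mathlib + `Common.SL2ConeMeasure`; module 2/3
of C-COMMON-SL2BALL stage A (bus S15425; plan-4 g5's plate line S15469).  WHAT IS TYPED — the Fubini estimate behind the ball growth: `l1 a = ∑ i j, |a i j|` (the `ℓ¹` entry norm), `ball R =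
{a | l1 a ≤ R}` (closed, measurable, COMPACT: `isCompact_ball`), `l1V` the same norm on `V`;
`ρ ⁻¹' ball R ∩ D ⊆ E R := {1 < detV ≤ 4, l1V ≤ 2R} ⊆ E' R` (the box `|coordinates| ≤ 2R` with `1 < detV ≤ 4`);
the `p.2 1`-FIBRE of `E' R` at fixed `(p.1, p.2 0)` is `{y : 1 < a y − c ≤ 4}` with `a = p.1 0`, an interval of length
`3 / |a|` (`volume_fibre_le`), and lies in `[-2R, 2R]` anyway, so its measure is `≤ φ R a := if |a| < 1/R then 4R else 3/|a|`
(`volume_fibre_box_le`); Fubini twice (`Measure.prod_apply`, `MeasurableEquiv.finTwoArrow`, `lintegral_prod_mul`) gives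
**`volume_E'_le : vol (E' R) ≤ (4R) · (4R) · ∫_{-2R}^{2R} φ R`** and **`lintegral_φ_le : ∫_{-2R}^{2R} φ R ≤ 8 + 6 log (2R²)`**
for `R ≥ 1` (`4R` on `|x| ≤ 1/R`, `3/|x|` outside, `integral_inv`).  Module 3 (`SL2BallGrowth`) assembles the Haar bounds.
Crit-2's test S15430 (the `a = 0` slice): at `a = p.1 0 = 0` the fibre bound is the `|a| < 1/R` branch of `φ` (`4R`).
Nothing here says anything about the status of the Hodge conjecture for CM abelian varieties, which is NOT proved
(HC_CM is NOT proved by anyone in this repository).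
-/

set_option autoImplicit false

noncomputable section

open MeasureTheory Measure Set Function Topology
open scoped NNReal ENNReal Pointwise MatrixGroups

namespace Summit.Ventures.HodgeRepro.Tier4.Common
namespace SL2Ball

/-! ## 5. The `ℓ¹` entry norm, the ball, and the region its cone lies in -/

/-- The `ℓ¹` norm of the entries of `a ∈ SL(2, ℝ)`. -/
def l1 (a : SL(2, ℝ)) : ℝ := ∑ i : Fin 2, ∑ j : Fin 2, |a i j|

/-- `l1 a ≥ 0`. -/
theorem l1_nonneg (a : SL(2, ℝ)) : 0 ≤ l1 a :=
  Finset.sum_nonneg fun _ _ => Finset.sum_nonneg fun _ _ => abs_nonneg _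

/-- `l1` is continuous. -/
theorem continuous_l1 : Continuous l1 := by
  unfold l1
  have hv : Continuous (fun a : SL(2, ℝ) => (a : Matrix (Fin 2) (Fin 2) ℝ)) := continuous_subtype_val
  exact continuous_finsetSum _ fun i _ => continuous_finsetSum _ fun j _ => (hv.matrix_elem i j).abs

/-- The `ℓ¹` ball `{a ∈ SL(2, ℝ) | ‖a‖₁ ≤ R}`. -/
def ball (R : ℝ) : Set SL(2, ℝ) := {a | l1 a ≤ R}

/-- The `ℓ¹` ball is measurable. -/
theorem measurableSet_ball [MeasurableSpace SL(2, ℝ)] [BorelSpace SL(2, ℝ)] (R : ℝ) : MeasurableSet (ball R) :=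
  measurableSet_le continuous_l1.measurable measurable_const

/-- The `ℓ¹` ball is compact: closed in `SL(2, ℝ)` and contained in the preimage of a box of `M₂(ℝ)`. -/
theorem isCompact_ball (R : ℝ) : IsCompact (ball R) := by
  have hcl : IsClosed (ball R) := isClosed_le continuous_l1 continuous_const
  have hK : IsCompact (Set.pi univ (fun _ : Fin 2 => Set.pi univ (fun _ : Fin 2 => Icc (-R) R)) :
      Set (Matrix (Fin 2) (Fin 2) ℝ)) :=
    isCompact_univ_pi fun _ => isCompact_univ_pi fun _ => isCompact_Icc
  have hbd : ball R ⊆ Subtype.val ⁻¹'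
      (Set.pi univ (fun _ : Fin 2 => Set.pi univ (fun _ : Fin 2 => Icc (-R) R)) : Set (Matrix (Fin 2) (Fin 2) ℝ)) := by
    intro a ha
    show (Subtype.val a : Fin 2 → Fin 2 → ℝ) ∈ Set.pi univ fun _ : Fin 2 => Set.pi univ fun _ : Fin 2 => Icc (-R) R
    rw [Set.mem_univ_pi]
    intro i
    rw [Set.mem_univ_pi]
    intro j
    rw [mem_Icc, ← abs_le]
    calc |a i j| ≤ ∑ j : Fin 2, |a i j| := Finset.single_le_sum (fun j _ => abs_nonneg (a i j)) (Finset.mem_univ j)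
      _ ≤ ∑ i : Fin 2, ∑ j : Fin 2, |a i j| :=
          Finset.single_le_sum (fun i _ => Finset.sum_nonneg fun j _ => abs_nonneg (a i j)) (Finset.mem_univ i)
      _ ≤ R := ha
  exact (Matrix.SpecialLinearGroup.isClosedEmbedding_val.isCompact_preimage hK).of_isClosed_subset hcl hbd

/-- The `ℓ¹` norm on `V`. -/
def l1V (p : V) : ℝ := ∑ i : Fin 2, |p.1 i| + ∑ i : Fin 2, |p.2 i|

/-- `l1V (ι a) = l1 a`. -/
theorem l1V_ι (a : SL(2, ℝ)) : l1V (ι a) = l1 a := by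
  simp only [l1V, l1, ι, colsOf, Fin.sum_univ_two]
  ring

/-- `l1V (t • p) = t * l1V p` for `t ≥ 0`. -/
theorem l1V_smul {t : ℝ} (ht : 0 ≤ t) (p : V) : l1V (t • p) = t * l1V p := by
  simp only [l1V, Prod.smul_fst, Prod.smul_snd, Pi.smul_apply, smul_eq_mul, abs_mul, abs_of_nonneg ht,
    Finset.mul_sum, mul_add]

/-- The region in which the cone over the ball lies. -/
def E (R : ℝ) : Set V := {p | 1 < detV p ∧ detV p ≤ 4 ∧ l1V p ≤ 2 * R}

/-- The cone over the ball lies in `E R`: `p = √(detV p) • ι (ρ p)` with `√(detV p) ≤ 2` and `l1 (ρ p) ≤ R`. -/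
theorem preimage_ball_inter_D_subset (R : ℝ) : ρ ⁻¹' ball R ∩ D ⊆ E R := by
  rintro p ⟨hpB, hpD⟩
  have hpos := pos_of_mem_D hpD
  refine ⟨hpD.1, hpD.2, ?_⟩
  have hl : l1V p = Real.sqrt (detV p) * l1 (ρ p) := by
    rw [← l1V_ι, ← l1V_smul (Real.sqrt_nonneg _), smul_ι_ρ hpos]
  have hs : Real.sqrt (detV p) ≤ 2 := by
    have h4 : Real.sqrt 4 = 2 := by
      rw [show (4 : ℝ) = 2 ^ 2 by norm_num, Real.sqrt_sq (by norm_num)]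
    exact h4 ▸ Real.sqrt_le_sqrt hpD.2
  rw [hl]
  exact mul_le_mul hs hpB (l1_nonneg _) (by norm_num)

/-- The box-shaped region used for the Fubini estimate. -/
def E' (R : ℝ) : Set V :=
  {p | |p.1 0| ≤ 2 * R ∧ |p.1 1| ≤ 2 * R ∧ |p.2 0| ≤ 2 * R ∧ |p.2 1| ≤ 2 * R ∧ 1 < detV p ∧ detV p ≤ 4}

/-- `E R ⊆ E' R`: each coordinate is bounded by the `ℓ¹` norm. -/
theorem E_subset_E' (R : ℝ) : E R ⊆ E' R := by
  rintro p ⟨h1, h4, hl⟩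
  simp only [l1V, Fin.sum_univ_two] at hl
  have := abs_nonneg (p.1 0); have := abs_nonneg (p.1 1); have := abs_nonneg (p.2 0); have := abs_nonneg (p.2 1)
  exact ⟨by linarith, by linarith, by linarith, by linarith, h1, h4⟩

/-- `E' R` is measurable. -/
theorem measurableSet_E' (R : ℝ) : MeasurableSet (E' R) := by
  have h0 : Measurable fun p : V => |p.1 0| := (measurable_pi_apply 0).comp measurable_fst |>.abs
  have h1 : Measurable fun p : V => |p.1 1| := (measurable_pi_apply 1).comp measurable_fst |>.abs
  have h2 : Measurable fun p : V => |p.2 0| := (measurable_pi_apply 0).comp measurable_snd |>.abs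
  have h3 : Measurable fun p : V => |p.2 1| := (measurable_pi_apply 1).comp measurable_snd |>.abs
  exact (measurableSet_le h0 measurable_const).inter ((measurableSet_le h1 measurable_const).inter
    ((measurableSet_le h2 measurable_const).inter ((measurableSet_le h3 measurable_const).inter
    ((measurableSet_lt measurable_const continuous_detV.measurable).inter
    (measurableSet_le continuous_detV.measurable measurable_const)))))

/-! ## 6. The Fubini estimate -/

/-- For `a ≠ 0`, the set `{y | 1 < a * y - c ≤ 4}` is an interval of length `3 / |a|`. -/
theorem volume_fibre_le {a c : ℝ} (ha : a ≠ 0) :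
    volume {y : ℝ | 1 < a * y - c ∧ a * y - c ≤ 4} ≤ ENNReal.ofReal (3 / |a|) := by
  rcases lt_or_gt_of_ne ha with ha' | ha'
  · have hset : {y : ℝ | 1 < a * y - c ∧ a * y - c ≤ 4} = Ico ((4 + c) / a) ((1 + c) / a) := by
      ext y
      simp only [mem_setOf_eq, mem_Ico]
      rw [div_le_iff_of_neg ha', lt_div_iff_of_neg ha']
      constructor
      · rintro ⟨h1, h4⟩
        constructor <;> linarith
      · rintro ⟨h4, h1⟩
        constructor <;> linarith
    rw [hset, Real.volume_Ico, abs_of_neg ha']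
    apply le_of_eq
    congr 1
    field_simp
    ring
  · have hset : {y : ℝ | 1 < a * y - c ∧ a * y - c ≤ 4} = Ioc ((1 + c) / a) ((4 + c) / a) := by
      ext y
      simp only [mem_setOf_eq, mem_Ioc]
      rw [div_lt_iff₀ ha', le_div_iff₀ ha']
      constructor
      · rintro ⟨h1, h4⟩
        constructor <;> linarith
      · rintro ⟨h1, h4⟩
        constructor <;> linarith
    rw [hset, Real.volume_Ioc, abs_of_pos ha']
    apply le_of_eq
    congr 1
    field_simp
    ring

/-- The fibre-length bound as a function of the coordinate `a = p.1 0`: `4R` near `a = 0`, else `3 / |a|`. -/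
def φ (R x : ℝ) : ℝ := if |x| < 1 / R then 4 * R else 3 / |x|

/-- `φ R x ≥ 0` for `R ≥ 0`. -/
theorem φ_nonneg {R x : ℝ} (hR : 0 ≤ R) : 0 ≤ φ R x := by
  unfold φ
  split_ifs <;> positivity

/-- `φ R` is measurable. -/
theorem measurable_φ (R : ℝ) : Measurable (φ R) :=
  Measurable.ite (measurableSet_lt measurable_abs measurable_const) measurable_const
    (measurable_const.div measurable_abs)

/-- The `y`-fibre `{y | |y| ≤ 2R ∧ 1 < a y − c ≤ 4}` has measure at most `φ R a`. -/
theorem volume_fibre_box_le {R a c : ℝ} (hR : 0 < R) :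
    volume {y : ℝ | |y| ≤ 2 * R ∧ 1 < a * y - c ∧ a * y - c ≤ 4} ≤ ENNReal.ofReal (φ R a) := by
  unfold φ
  split_ifs with h
  · calc volume {y : ℝ | |y| ≤ 2 * R ∧ 1 < a * y - c ∧ a * y - c ≤ 4}
        ≤ volume (Icc (-(2 * R)) (2 * R)) := measure_mono fun y hy => abs_le.1 hy.1
      _ = ENNReal.ofReal (4 * R) := by
          rw [Real.volume_Icc]
          congr 1
          ring
  · have ha : a ≠ 0 := by
      rintro rfl
      exact h (by rw [abs_zero]; positivity)
    exact (measure_mono fun y hy => hy.2).trans (volume_fibre_le ha)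

/-- The `v`-slice of `E' R` at `u`, in the coordinates `(v 0, v 1)`. -/
def sliceSet (R : ℝ) (u : Fin 2 → ℝ) : Set (ℝ × ℝ) :=
  {q | |q.1| ≤ 2 * R ∧ |q.2| ≤ 2 * R ∧ 1 < u 0 * q.2 - u 1 * q.1 ∧ u 0 * q.2 - u 1 * q.1 ≤ 4}

/-- `sliceSet R u` is measurable. -/
theorem measurableSet_sliceSet (R : ℝ) (u : Fin 2 → ℝ) : MeasurableSet (sliceSet R u) := by
  have hm : Measurable fun q : ℝ × ℝ => u 0 * q.2 - u 1 * q.1 := by fun_prop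
  exact (measurableSet_le measurable_fst.abs measurable_const).inter
    ((measurableSet_le measurable_snd.abs measurable_const).inter
      ((measurableSet_lt measurable_const hm).inter (measurableSet_le hm measurable_const)))

/-- The slice bound: `vol (sliceSet R u) ≤ 4R · φ R (u 0)` (Fubini in `(v 0, v 1)`, the `v 1`-fibre bounded by `volume_fibre_box_le`). -/
theorem volume_sliceSet_le {R : ℝ} (hR : 0 < R) (u : Fin 2 → ℝ) :
    volume (sliceSet R u) ≤ ENNReal.ofReal (4 * R) * ENNReal.ofReal (φ R (u 0)) := by
  rw [Measure.volume_eq_prod, Measure.prod_apply (measurableSet_sliceSet R u)]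
  have hpt : ∀ x : ℝ, volume (Prod.mk x ⁻¹' sliceSet R u) ≤
      (Icc (-(2 * R)) (2 * R)).indicator (fun _ => ENNReal.ofReal (φ R (u 0))) x := by
    intro x
    by_cases hx : x ∈ Icc (-(2 * R)) (2 * R)
    · rw [indicator_of_mem hx]
      refine (measure_mono ?_).trans (volume_fibre_box_le (a := u 0) (c := u 1 * x) hR)
      intro y hy
      exact ⟨hy.2.1, hy.2.2.1, hy.2.2.2⟩
    · rw [indicator_of_notMem hx]
      have : Prod.mk x ⁻¹' sliceSet R u = ∅ := by
        ext y
        simp only [mem_preimage, sliceSet, mem_setOf_eq, mem_empty_iff_false, iff_false]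
        intro hy
        exact hx (abs_le.1 hy.1)
      rw [this, measure_empty]
  calc ∫⁻ x, volume (Prod.mk x ⁻¹' sliceSet R u)
      ≤ ∫⁻ x, (Icc (-(2 * R)) (2 * R)).indicator (fun _ => ENNReal.ofReal (φ R (u 0))) x := lintegral_mono hpt
    _ = ENNReal.ofReal (φ R (u 0)) * volume (Icc (-(2 * R)) (2 * R)) := lintegral_indicator_const measurableSet_Icc _
    _ = ENNReal.ofReal (4 * R) * ENNReal.ofReal (φ R (u 0)) := by
        rw [Real.volume_Icc, mul_comm]
        congr 2
        ring

/-- The Fubini estimate: `vol (E' R) ≤ (4R)² ∫_{-2R}^{2R} φ`. -/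
theorem volume_E'_le {R : ℝ} (hR : 0 < R) :
    volume (E' R) ≤ ENNReal.ofReal (4 * R) * ENNReal.ofReal (4 * R) *
      ∫⁻ x in Icc (-(2 * R)) (2 * R), ENNReal.ofReal (φ R x) := by
  rw [Measure.volume_eq_prod, Measure.prod_apply (measurableSet_E' R)]
  set f : ℝ → ℝ≥0∞ :=
    fun x => (Icc (-(2 * R)) (2 * R)).indicator (fun x => ENNReal.ofReal (4 * R) * ENNReal.ofReal (φ R x)) x with hf_def
  set g : ℝ → ℝ≥0∞ := fun y => (Icc (-(2 * R)) (2 * R)).indicator (fun _ => (1 : ℝ≥0∞)) y with hg_def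
  have hf : Measurable f :=
    (measurable_const.mul (ENNReal.measurable_ofReal.comp (measurable_φ R))).indicator measurableSet_Icc
  have hg : Measurable g := measurable_const.indicator measurableSet_Icc
  have hpt : ∀ u : Fin 2 → ℝ, volume (Prod.mk u ⁻¹' E' R) ≤ f (u 0) * g (u 1) := by
    intro u
    by_cases hu : |u 0| ≤ 2 * R ∧ |u 1| ≤ 2 * R
    · have h0 : u 0 ∈ Icc (-(2 * R)) (2 * R) := abs_le.1 hu.1
      have h1 : u 1 ∈ Icc (-(2 * R)) (2 * R) := abs_le.1 hu.2
      simp only [hf_def, hg_def, indicator_of_mem h0, indicator_of_mem h1, mul_one]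
      calc volume (Prod.mk u ⁻¹' E' R) ≤ volume (MeasurableEquiv.finTwoArrow ⁻¹' sliceSet R u) := by
            refine measure_mono fun v hv => ?_
            exact ⟨hv.2.2.1, hv.2.2.2.1, hv.2.2.2.2.1, hv.2.2.2.2.2⟩
        _ = volume (sliceSet R u) := (volume_preserving_finTwoArrow ℝ).measure_preimage_equiv _
        _ ≤ _ := volume_sliceSet_le hR u
    · have : Prod.mk u ⁻¹' E' R = ∅ := by
        ext v
        simp only [mem_preimage, E', mem_setOf_eq, mem_empty_iff_false, iff_false]
        intro hv
        exact hu ⟨hv.1, hv.2.1⟩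
      rw [this, measure_empty]
      exact zero_le
  have hfg : Measurable fun q : ℝ × ℝ => f q.1 * g q.2 := (hf.comp measurable_fst).mul (hg.comp measurable_snd)
  calc ∫⁻ u, volume (Prod.mk u ⁻¹' E' R) ≤ ∫⁻ u, f (u 0) * g (u 1) := lintegral_mono hpt
    _ = ∫⁻ q : ℝ × ℝ, f q.1 * g q.2 := by
        rw [← (volume_preserving_finTwoArrow ℝ).lintegral_comp hfg]
        rfl
    _ = (∫⁻ x, f x) * ∫⁻ y, g y := by
        rw [Measure.volume_eq_prod]
        exact lintegral_prod_mul hf.aemeasurable hg.aemeasurable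
    _ = (ENNReal.ofReal (4 * R) * ∫⁻ x in Icc (-(2 * R)) (2 * R), ENNReal.ofReal (φ R x)) *
          ENNReal.ofReal (4 * R) := by
        simp only [hf_def, hg_def]
        rw [lintegral_indicator measurableSet_Icc, lintegral_indicator_const measurableSet_Icc, one_mul,
          Real.volume_Icc, lintegral_const_mul (ENNReal.ofReal (4 * R)) (measurable_φ R).ennreal_ofReal,
          show (2 * R - -(2 * R)) = 4 * R by ring]
    _ = _ := by ring

/-- The one-dimensional integral: `∫_{-2R}^{2R} φ ≤ 8 + 6 log (2R²)` for `R ≥ 1`. -/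
theorem lintegral_φ_le {R : ℝ} (hR : 1 ≤ R) :
    ∫⁻ x in Icc (-(2 * R)) (2 * R), ENNReal.ofReal (φ R x) ≤ ENNReal.ofReal (8 + 6 * Real.log (2 * R ^ 2)) := by
  have hR0 : 0 < R := by linarith
  have hRinv0 : 0 < 1 / R := by positivity
  have hRinv : 1 / R ≤ 2 * R := by
    rw [div_le_iff₀ hR0]
    nlinarith
  have hlog : 0 ≤ Real.log (2 * R ^ 2) := Real.log_nonneg (by nlinarith)
  have hsub : Icc (-(2 * R)) (2 * R) ⊆
      Icc (-(2 * R)) (-(1 / R)) ∪ (Icc (-(1 / R)) (1 / R) ∪ Icc (1 / R) (2 * R)) := by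
    intro x hx
    simp only [mem_Icc, mem_union] at hx ⊢
    by_cases h1 : x ≤ -(1 / R)
    · exact Or.inl ⟨hx.1, h1⟩
    · by_cases h2 : x ≤ 1 / R
      · exact Or.inr (Or.inl ⟨by linarith, h2⟩)
      · exact Or.inr (Or.inr ⟨by linarith, hx.2⟩)
  -- the middle piece: `φ ≤ 4R` on `|x| ≤ 1/R`
  have hmid : ∫⁻ x in Icc (-(1 / R)) (1 / R), ENNReal.ofReal (φ R x) ≤ ENNReal.ofReal 8 := by
    calc ∫⁻ x in Icc (-(1 / R)) (1 / R), ENNReal.ofReal (φ R x)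
        ≤ ∫⁻ _ in Icc (-(1 / R)) (1 / R), ENNReal.ofReal (4 * R) := by
          refine setLIntegral_mono' measurableSet_Icc fun x hx => ENNReal.ofReal_le_ofReal ?_
          unfold φ
          split_ifs with h
          · exact le_rfl
          · have hxe : |x| = 1 / R := le_antisymm (abs_le.2 hx) (not_lt.1 h)
            rw [hxe, div_div_eq_mul_div, div_one]
            linarith
      _ = ENNReal.ofReal (4 * R) * volume (Icc (-(1 / R)) (1 / R)) := setLIntegral_const _ _
      _ = ENNReal.ofReal 8 := by
          rw [Real.volume_Icc, ← ENNReal.ofReal_mul (by positivity)]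
          congr 1
          field_simp
          ring
  -- the positive piece: `φ = 3 / x` on `[1/R, 2R]`
  have hpos : ∫⁻ x in Icc (1 / R) (2 * R), ENNReal.ofReal (φ R x) ≤ ENNReal.ofReal (3 * Real.log (2 * R ^ 2)) := by
    have heq : EqOn (fun x => ENNReal.ofReal (φ R x)) (fun x => ENNReal.ofReal (3 * x⁻¹)) (Icc (1 / R) (2 * R)) := by
      intro x hx
      have hx0 : 0 < x := lt_of_lt_of_le hRinv0 hx.1
      have hnot : ¬ |x| < 1 / R := by
        rw [abs_of_pos hx0]
        exact not_lt.2 hx.1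
      show ENNReal.ofReal (φ R x) = ENNReal.ofReal (3 * x⁻¹)
      unfold φ
      rw [if_neg hnot, abs_of_pos hx0, div_eq_mul_inv]
    have hcont : ContinuousOn (fun x : ℝ => 3 * x⁻¹) (Icc (1 / R) (2 * R)) := by
      refine continuousOn_const.mul (continuousOn_inv₀.mono ?_)
      intro x hx
      exact (lt_of_lt_of_le hRinv0 hx.1).ne'
    have hnn : 0 ≤ᵐ[volume.restrict (Icc (1 / R) (2 * R))] fun x : ℝ => 3 * x⁻¹ := by
      refine (ae_restrict_iff' measurableSet_Icc).2 (Filter.Eventually.of_forall fun x hx => ?_)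
      have hx0 : 0 < x := lt_of_lt_of_le hRinv0 hx.1
      positivity
    have h0 : (0 : ℝ) ∉ Set.uIcc (1 / R) (2 * R) := by
      rw [Set.uIcc_of_le hRinv]
      intro h
      linarith [h.1]
    have hratio : 2 * R / (1 / R) = 2 * R ^ 2 := by
      field_simp
    refine le_of_eq ?_
    calc ∫⁻ x in Icc (1 / R) (2 * R), ENNReal.ofReal (φ R x)
        = ∫⁻ x in Icc (1 / R) (2 * R), ENNReal.ofReal (3 * x⁻¹) := setLIntegral_congr_fun measurableSet_Icc heq
      _ = ENNReal.ofReal (∫ x in Icc (1 / R) (2 * R), 3 * x⁻¹) :=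
          (ofReal_integral_eq_lintegral_ofReal hcont.integrableOn_Icc hnn).symm
      _ = ENNReal.ofReal (3 * Real.log (2 * R ^ 2)) := by
          rw [integral_Icc_eq_integral_Ioc, ← intervalIntegral.integral_of_le hRinv,
            intervalIntegral.integral_const_mul, integral_inv h0, hratio]
  -- the negative piece: `φ = -3 / x` on `[-2R, -1/R]`
  have hneg : ∫⁻ x in Icc (-(2 * R)) (-(1 / R)), ENNReal.ofReal (φ R x) ≤
      ENNReal.ofReal (3 * Real.log (2 * R ^ 2)) := by
    have hle : -(2 * R) ≤ -(1 / R) := by linarith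
    have heq : EqOn (fun x => ENNReal.ofReal (φ R x)) (fun x => ENNReal.ofReal ((-3) * x⁻¹))
        (Icc (-(2 * R)) (-(1 / R))) := by
      intro x hx
      have hx0 : x < 0 := lt_of_le_of_lt hx.2 (by linarith)
      have hnot : ¬ |x| < 1 / R := by
        rw [abs_of_neg hx0]
        exact not_lt.2 (by linarith [hx.2])
      show ENNReal.ofReal (φ R x) = ENNReal.ofReal ((-3) * x⁻¹)
      unfold φ
      rw [if_neg hnot, abs_of_neg hx0, div_neg, div_eq_mul_inv, ← neg_mul]
    have hcont : ContinuousOn (fun x : ℝ => (-3) * x⁻¹) (Icc (-(2 * R)) (-(1 / R))) := by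
      refine continuousOn_const.mul (continuousOn_inv₀.mono ?_)
      intro x hx
      exact (lt_of_le_of_lt hx.2 (by linarith)).ne
    have hnn : 0 ≤ᵐ[volume.restrict (Icc (-(2 * R)) (-(1 / R)))] fun x : ℝ => (-3) * x⁻¹ := by
      refine (ae_restrict_iff' measurableSet_Icc).2 (Filter.Eventually.of_forall fun x hx => ?_)
      have hx0 : x < 0 := lt_of_le_of_lt hx.2 (by linarith)
      have : x⁻¹ < 0 := inv_lt_zero.2 hx0
      show (0 : ℝ) ≤ (-3) * x⁻¹
      nlinarith
    have h0 : (0 : ℝ) ∉ Set.uIcc (-(2 * R)) (-(1 / R)) := by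
      rw [Set.uIcc_of_le hle]
      intro h
      linarith [h.2]
    have hratio : -(1 / R) / -(2 * R) = (2 * R ^ 2)⁻¹ := by
      field_simp
    refine le_of_eq ?_
    calc ∫⁻ x in Icc (-(2 * R)) (-(1 / R)), ENNReal.ofReal (φ R x)
        = ∫⁻ x in Icc (-(2 * R)) (-(1 / R)), ENNReal.ofReal ((-3) * x⁻¹) :=
          setLIntegral_congr_fun measurableSet_Icc heq
      _ = ENNReal.ofReal (∫ x in Icc (-(2 * R)) (-(1 / R)), (-3) * x⁻¹) :=
          (ofReal_integral_eq_lintegral_ofReal hcont.integrableOn_Icc hnn).symm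
      _ = ENNReal.ofReal (3 * Real.log (2 * R ^ 2)) := by
          rw [integral_Icc_eq_integral_Ioc, ← intervalIntegral.integral_of_le hle,
            intervalIntegral.integral_const_mul, integral_inv h0, hratio, Real.log_inv]
          ring_nf
  calc ∫⁻ x in Icc (-(2 * R)) (2 * R), ENNReal.ofReal (φ R x)
      ≤ ∫⁻ x in Icc (-(2 * R)) (-(1 / R)) ∪ (Icc (-(1 / R)) (1 / R) ∪ Icc (1 / R) (2 * R)),
          ENNReal.ofReal (φ R x) := lintegral_mono_set hsub
    _ ≤ (∫⁻ x in Icc (-(2 * R)) (-(1 / R)), ENNReal.ofReal (φ R x)) +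
          ((∫⁻ x in Icc (-(1 / R)) (1 / R), ENNReal.ofReal (φ R x)) +
            ∫⁻ x in Icc (1 / R) (2 * R), ENNReal.ofReal (φ R x)) :=
        (lintegral_union_le _ _ _).trans (add_le_add le_rfl (lintegral_union_le _ _ _))
    _ ≤ ENNReal.ofReal (3 * Real.log (2 * R ^ 2)) + (ENNReal.ofReal 8 + ENNReal.ofReal (3 * Real.log (2 * R ^ 2))) :=
        add_le_add hneg (add_le_add hmid hpos)
    _ = ENNReal.ofReal (8 + 6 * Real.log (2 * R ^ 2)) := by
        rw [← ENNReal.ofReal_add (by norm_num) (by positivity), ← ENNReal.ofReal_add (by positivity) (by positivity)]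
        congr 1
        ring

end SL2Ball

end Summit.Ventures.HodgeRepro.Tier4.Common
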